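import Summits.HodgeConjecture.HodgeConjecture.Theorems.MarkmanPartnerTransportPicardThreeK3SquaresRMSpread
import Literature.AlgebraicGeometry.Motives.ConstantFamilyFibre
import Literature.AlgebraicGeometry.Motives.VarietiesProjectiveSpaceProofs
import Literature.AlgebraicGeometry.HodgeTheory.ZariskiClosedNowhereDense
import Literature.AlgebraicGeometry.HodgeTheory.GysinFormalismPushforward
import Literature.AlgebraicGeometry.HodgeTheory.CorrespondenceCupProductIdentities
import Literature.AlgebraicGeometry.HodgeTheory.InvariantClassesFromTotalSpaceHolds
import Literature.AlgebraicGeometry.HodgeTheory.AlgebraicClassesPullback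

/-!
# Route MarkmanPartnerTransport · crux `PicardThreeK3Squares` (stmt-HodgeConjecture-19652) —
# the input structure `RMSpreadFamily` is INHABITED exactly when the generator is cycle-induced
# (non-vacuity of the line «maximal-family spread»; its input is lossless)

`RMSpreadFamily S hS t` (`Theorems/MarkmanPartnerTransportRMSpreadDefs`) packages the one input of the
variational line on the real-multiplication third: a smooth projective family through `S ⊗ S`, the
endomorphism `t` as a flat section, a dominant cycle-carrying classifying morphism. Its consumer shows
`RMSpreadFamily S hS t ⟹ t` cycle-induced (`RMSpreadFamily.exists_algebraicClass`, unconditional via `deligne1968_invariantClass_fromTotalSpace_holds`). This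
file proves the CONVERSE, so the structure is (i) jointly satisfiable — a vacuity guard for referees —
and (ii) EQUIVALENT to cycle-inducedness of `t`, i.e. the line asks of moduli theory nothing stronger
than what the Hodge conjecture for `S × S` needs:

* `nonempty_rmSpreadFamily_of_exists_algebraicClass` — if `t = [γ]_*` for an algebraic `γ` on `S × S`, the
  CONSTANT family `pr₂ : (S ⊗ S) ⊗ ℙ¹ ⟶ ℙ¹` (tree: `isSmoothProjectiveFamily_snd`, `sliceFiberIso`), with the
  global section of `pr₁^* γ` as flat section and `𝟙_{ℙ¹}` as (dominant) classifying morphism, is an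
  `RMSpreadFamily S hS t`; every fibre value is the pull-back of `γ` along the slice isomorphism, hence
  algebraic (`map_mem_algebraicClasses_of_isIso`);
* `nonempty_rmSpreadFamily_iff_exists_algebraicClass` — **`Nonempty (RMSpreadFamily S hS t) ↔ t` is induced
  by an algebraic class on `S × S`** (⇐ above, ⇒ `RMSpreadFamily.exists_algebraicClass`);
* `nonempty_rmSpreadFamily_iff_isCycleInducedTranscendentalEndomorphism` — for `t` rational,
  type-preserving, killing `N¹` with image `⊥ N¹`: `Nonempty (RMSpreadFamily S hS t) ↔
  IsCycleInducedTranscendentalEndomorphism S hS t` (van Geemen–Schütt's notion, the shape of the tree's vGS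
  facts);
* `isCycleInducedRMK3_iff_isRealMultiplicationK3_and_spreadFamilies` — `IsCycleInducedRMK3 S ρ P ↔
  IsRealMultiplicationK3 S ρ P ∧` (some generator as in the definition admits a spread family).

Everything unconditional (no named fact, no sorry, no definition). Prover seat hodge-nonav-19652-p1 (gen 7),
`--supports stmt-HodgeConjecture-19652`. Nothing here proves the crux or the Hodge conjecture.

References: Hartshorne, *Algebraic Geometry*, II.3 (fibres), III Prop. 10.1 (b); van Geemen–Schütt,
Forum Math. Sigma 13 (2025) e2, §4.8; Voisin, *Hodge Theory II* (2003), §7.3.2.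
-/

set_option linter.dupNamespace false

noncomputable section

namespace Summit.HodgeConjecture.HodgeConjecture.Theorems.MarkmanPartnerTransport

open CategoryTheory MonoidalCategory CartesianMonoidalCategory AlgebraicGeometry Polynomial
open Literature.AlgebraicGeometry Literature.AlgebraicGeometry.Motives Literature.AlgebraicGeometry.HodgeTheory
open Literature.AlgebraicGeometry.Surfaces
open Literature.AlgebraicTopology.SingularHomology

variable {S : SchemeOver ℂ} {hS : IsSmoothProjective 2 S}
  {t : complexBetti S (2 * 1) →ₗ[ℂ] complexBetti S (2 * 1)}

/-- **A cycle-induced endomorphism has a (constant) spread family.** If `t = pr₁_*(pr₂^*(–) ∪ γ)` for an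
algebraic class `γ ∈ N²H⁴((S ⊗ S)(ℂ))`, then `RMSpreadFamily S hS t` is inhabited by the constant family
`pr₂ : (S ⊗ S) ⊗ ℙ¹ ⟶ ℙ¹` (a smooth projective family, `isSmoothProjectiveFamily_snd`; base `ℙ¹` smooth,
irreducible, projective; total space projective by Segre), the flat section `b ↦ (b, (pr₁^* γ)|_b)`
(`globalSection`), the slice isomorphism `S ⊗ S ≅ ((S ⊗ S) ⊗ ℙ¹)_b` at any complex point `b` of `ℙ¹`
(`sliceFiberIso`: composed with the fibre inclusion and `pr₁` it is the identity, so the section's value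
pulls back to `γ` and induces `t`), and the identity of `ℙ¹` as dominant classifying morphism (every fibre
value is `γ` pulled back along the inverse slice isomorphism, hence algebraic).
[cite: Hartshorne1977, II.3 (p. 89) and III Prop. 10.1 (b)] [cite: GeemenSchutt2023, §4.8] -/
theorem nonempty_rmSpreadFamily_of_exists_algebraicClass (hS : IsSmoothProjective 2 S)
    (t : complexBetti S (2 * 1) →ₗ[ℂ] complexBetti S (2 * 1))
    (hγt : ∃ γ ∈ algebraicClasses (S ⊗ S) 2, ∀ y : complexBetti S (2 * 1),
      t y = complexGysin complexOrientationFamily (IsSmoothProjective.tensor_holds hS hS) hS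
        (SemiCartesianMonoidalCategory.fst S S) (rfl : 2 * 1 + 2 * 2 + 2 * 2 = 2 * 1 + 2 * (2 + 2))
        (cupProduct (rfl : 2 * 1 + 2 * 2 = 2 * 1 + 2 * 2)
          (complexBetti.map (SemiCartesianMonoidalCategory.snd S S) (2 * 1) y) γ)) :
    Nonempty (RMSpreadFamily S hS t) := by
  obtain ⟨γ, hγ, ht⟩ := hγt
  -- the base `ℙ¹` and the constant family `pr₂ : (S ⊗ S) ⊗ ℙ¹ ⟶ ℙ¹`
  set P : SchemeOver ℂ := projectiveSpace 1 ℂ with hP_def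
  have hP : IsSmoothProjective 1 P := isSmoothProjective_projectiveSpace_holds ℂ 1
  have hSS : IsSmoothProjective (2 + 2) (S ⊗ S) := IsSmoothProjective.tensor_holds hS hS
  have hTot : IsSmoothProjective ((2 + 2) + 1) ((S ⊗ S) ⊗ P) := IsSmoothProjective.tensor_holds hSS hP
  haveI := hP.smoothOfRelativeDimension
  have hPsm : AlgebraicGeometry.Smooth P.hom := SmoothOfRelativeDimension.smooth 1 P.hom
  have hPirr : IrreducibleSpace P.left := irreducibleSpace_of_isSmoothProjective' hP
  have hPqp : IsQuasiProjectiveOver P := IsQuasiProjectiveOver.of_isProjectiveOver hP.isProjectiveOver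
  haveI : IsSeparated P.hom := hPqp.isVarietyPair_ofScheme.isSeparated
  haveI : LocallyOfFiniteType P.hom := locallyOfFiniteType_of_isQuasiProjectiveOver hPqp
  obtain ⟨b₁⟩ := nonempty_complexPoints hP
  let g : (S ⊗ S) ⊗ P ⟶ P := snd (S ⊗ S) P
  let W : complexBetti ((S ⊗ S) ⊗ P) (2 * 2) := complexBetti.map (fst (S ⊗ S) P) (2 * 2) γ
  -- the fibre values of the global section of `W` are `γ` pulled back along the inverse slice isomorphism
  have hval : ∀ b : ComplexPoints P,
      complexBetti.map (fiberι g b) (2 * 2) W =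
        complexBetti.map (sliceFiberIso (S ⊗ S) b).inv (2 * 2) γ := by
    intro b
    have hcomp : fiberι g b ≫ fst (S ⊗ S) P = (sliceFiberIso (S ⊗ S) b).inv := by
      rw [← cancel_epi (sliceFiberIso (S ⊗ S) b).hom, Iso.hom_inv_id]
      exact sliceFiberIso_hom_fiberι_fst (S ⊗ S) b
    change complexBetti.map (fiberι g b) (2 * 2) (complexBetti.map (fst (S ⊗ S) P) (2 * 2) γ) = _
    rw [← complexBetti.map_comp_apply', hcomp]
  have halg : ∀ b : ComplexPoints P,
      complexBetti.map (fiberι g b) (2 * 2) W ∈ algebraicClasses (fiberOver g b) 2 := by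
    intro b
    rw [hval b]
    exact map_mem_algebraicClasses_of_isIso (sliceFiberIso (S ⊗ S) b).inv hγ
  -- pulled back along the slice isomorphism the value at `b₁` is `γ` itself
  have hback : complexBetti.map (sliceFiberIso (S ⊗ S) b₁).hom (2 * 2)
      (complexBetti.map (fiberι g b₁) (2 * 2) W) = γ := by
    rw [hval b₁, ← complexBetti.map_comp_apply', Iso.hom_inv_id, complexBetti.map_id, ModuleCat.id_apply]
  -- the value of the global section at `b`, read in the fibre over `b`
  have hcls : ∀ b : ComplexPoints P,
      (globalSection g (2 * 2) W b).clsAt (t := b) rfl = complexBetti.map (fiberι g b) (2 * 2) W :=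
    fun b => rfl
  refine ⟨{
    base := P
    total := (S ⊗ S) ⊗ P
    family := g
    relDim := 2 + 2
    isSmoothProjectiveFamily := isSmoothProjectiveFamily_snd hSS P
    total_quasiProjective := IsQuasiProjectiveOver.of_isProjectiveOver hTot.isProjectiveOver
    base_quasiProjective := hPqp
    base_smooth := hPsm
    base_irreducible := hPirr
    flatSection := globalSection g (2 * 2) W
    flatSection_continuous := continuous_globalSection g (2 * 2) W
    flatSection_pt := fun b => rfl
    pt₁ := b₁
    fibreIso := sliceFiberIso (S ⊗ S) b₁
    induces := ?_
    param := P
    classify := 𝟙 P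
    param_irreducible := hPirr
    param_isSeparated := inferInstance
    param_locallyOfFiniteType := inferInstance
    param_nonempty := ⟨b₁⟩
    classify_denseRange := fun x => subset_closure ⟨x, rfl⟩
    algebraic_over_param := fun v => ?_ }⟩
  · intro y
    rw [hcls b₁, hback]
    exact ht y
  · rw [hcls (AlgPoints.map (𝟙 P) v)]
    exact halg _

/-- **`RMSpreadFamily S hS t` is inhabited iff `t` is induced by an algebraic class on `S × S`.** The input
of the line «maximal-family spread» is LOSSLESS: it holds exactly when its pay-off (cycle-inducedness of the
generator) does. (⇒ `RMSpreadFamily.exists_algebraicClass` with the tree's `deligne1968_invariantClass_fromTotalSpace_holds`, the spread; ⇐ the constant family,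
`nonempty_rmSpreadFamily_of_exists_algebraicClass`.) [cite: GeemenSchutt2023, §4.8]
[cite: VoisinHodgeII2003, §7.3.2] -/
theorem nonempty_rmSpreadFamily_iff_exists_algebraicClass (hS : IsSmoothProjective 2 S)
    (t : complexBetti S (2 * 1) →ₗ[ℂ] complexBetti S (2 * 1)) :
    Nonempty (RMSpreadFamily S hS t) ↔
      ∃ γ ∈ algebraicClasses (S ⊗ S) 2, ∀ y : complexBetti S (2 * 1),
        t y = complexGysin complexOrientationFamily (IsSmoothProjective.tensor_holds hS hS) hS
          (SemiCartesianMonoidalCategory.fst S S) (rfl : 2 * 1 + 2 * 2 + 2 * 2 = 2 * 1 + 2 * (2 + 2))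
          (cupProduct (rfl : 2 * 1 + 2 * 2 = 2 * 1 + 2 * 2)
            (complexBetti.map (SemiCartesianMonoidalCategory.snd S S) (2 * 1) y) γ) :=
  ⟨fun ⟨F⟩ => F.exists_algebraicClass deligne1968_invariantClass_fromTotalSpace_holds,
    nonempty_rmSpreadFamily_of_exists_algebraicClass hS t⟩

/-- **Spread family ⟺ cycle-induced transcendental endomorphism** (van Geemen–Schütt's notion): for `t`
rational, type-preserving, killing `N¹H²(S)` and with image cup-orthogonal to it,
`Nonempty (RMSpreadFamily S hS t) ↔ IsCycleInducedTranscendentalEndomorphism S hS t`.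
[cite: GeemenSchutt2023, §4.8 and §2.1] -/
theorem nonempty_rmSpreadFamily_iff_isCycleInducedTranscendentalEndomorphism (hS : IsSmoothProjective 2 S)
    (t : complexBetti S (2 * 1) →ₗ[ℂ] complexBetti S (2 * 1))
    (ht_rat : ∀ y, IsRationalClass y → IsRationalClass (t y))
    (ht_typ : ∀ (i j : ℕ) (y : complexBetti S (2 * 1)),
      IsOfHodgeType 2 S (2 * 1) i j y → IsOfHodgeType 2 S (2 * 1) i j (t y))
    (ht_N : ∀ d ∈ algebraicClasses S 1, t d = 0)
    (ht_perp : ∀ (y : complexBetti S (2 * 1)), ∀ d ∈ algebraicClasses S 1,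
      cupProduct (rfl : 2 * 1 + 2 * 1 = 2 * 2) (t y) d = 0) :
    Nonempty (RMSpreadFamily S hS t) ↔ IsCycleInducedTranscendentalEndomorphism S hS t :=
  ⟨fun ⟨F⟩ => F.isCycleInducedTranscendentalEndomorphism deligne1968_invariantClass_fromTotalSpace_holds
      ht_rat ht_typ ht_N ht_perp,
    fun h => nonempty_rmSpreadFamily_of_exists_algebraicClass hS t h.exists_mem_algebraicClasses⟩

/-- **`IsCycleInducedRMK3` ⟺ `IsRealMultiplicationK3` + a spread family for some generator.** A K3 surface
has cycle-induced real multiplication by `ℚ[X]/(P)` at Picard number `ρ` (the shape of the six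
van Geemen–Schütt facts) iff it is an RM K3 surface in the sense of `IsRealMultiplicationK3 S ρ P` one of
whose generators (rational, type-preserving, killing `N¹`, image `⊥ N¹`, `P(t) = 0` on `T`, generating
`End_Hdg(T)`) admits a spread family. [cite: GeemenSchutt2023, §2.1 and §4.8] -/
theorem isCycleInducedRMK3_iff_isRealMultiplicationK3_and_spreadFamily (S : SchemeOver ℂ) (ρ : ℕ)
    (P : ℚ[X]) :
    IsCycleInducedRMK3 S ρ P ↔
      ∃ h : IsRealMultiplicationK3 S ρ P, ∃ t : complexBetti S (2 * 1) →ₗ[ℂ] complexBetti S (2 * 1),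
        (∀ y, IsRationalClass y → IsRationalClass (t y)) ∧
        (∀ (i j : ℕ) (y : complexBetti S (2 * 1)),
          IsOfHodgeType 2 S (2 * 1) i j y → IsOfHodgeType 2 S (2 * 1) i j (t y)) ∧
        (∀ d ∈ algebraicClasses S 1, t d = 0) ∧
        (∀ (y : complexBetti S (2 * 1)), ∀ d ∈ algebraicClasses S 1,
          cupProduct (rfl : 2 * 1 + 2 * 1 = 2 * 2) (t y) d = 0) ∧
        IsAnnihilatedOnTranscendentalBy S t P ∧ TranscendentalEndomorphismsGeneratedBy S t ∧
        Nonempty (RMSpreadFamily S h.isK3Surface.isSmoothProjective t) := by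
  constructor
  · intro h
    have hRM : IsRealMultiplicationK3 S ρ P := h.isRealMultiplicationK3
    obtain ⟨hK3, -, -, t, ht, hP, hgen⟩ := h
    obtain ⟨hrat, htyp, hN, hperp, hγ⟩ := ht
    exact ⟨hRM, t, hrat, htyp, hN, hperp, hP, hgen,
      nonempty_rmSpreadFamily_of_exists_algebraicClass hRM.isK3Surface.isSmoothProjective t hγ⟩
  · rintro ⟨h, t, hrat, htyp, hN, hperp, hP, hgen, ⟨F⟩⟩
    exact ⟨h.isK3Surface, h.finrank_algebraicClasses_one, h.not_hasComplexMultiplication, t,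
      F.isCycleInducedTranscendentalEndomorphism deligne1968_invariantClass_fromTotalSpace_holds
        hrat htyp hN hperp, hP, hgen⟩

end Summit.HodgeConjecture.HodgeConjecture.Theorems.MarkmanPartnerTransport
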